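import Mathlib.Analysis.SpecialFunctions.SmoothTransition
import Mathlib.MeasureTheory.Integral.IntervalIntegral.FundThmCalculus
import HarnessLib

/-!
# A cubic-growth barrier for the half-line Ornstein–Uhlenbeck operator `∂² + (C − ρ/2)∂`

Topic `Literature/Analysis/FluidPDE` (family `ns`).  The comparison function used by
`HalfLineOUComparison` (the Prop `NetFlux.HalfLineOUDecay` of crux `PoloidalLiouville`,
stmt-NavierStokesRegularity-1222, ns-idea-14's net-flux line): for `C ≥ 0` an explicit `K ∈ C²[0,∞)`
with `K″ + (C − ρ/2)K′ + λK ≤ 0` on `(0,∞)`, `1 ≤ K`, `ερ³ ≤ K ≤ k_M + ερ³` — namely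
`K(ρ) = 1 + β∫₀^ρ e^{σ²/4−βσ}χ(σ)dσ + ερ³`, `β = 2C+2`, `χ` a `Real.smoothTransition` cut-off equal to
`1` on `[0,2β]` and `0` beyond `4β` (harmonic scale of the operator, cut off so that `K` grows cubically),
`λ = ε = (C+2)βe^{−β²}/(3 + 12β + 12Cβ²)` (Gaussian order; the sharp rate — the principal Dirichlet
eigenvalue, `pub/ns-exp-scalarLiouville/MAP.md` Lemma 2.3 — is not claimed).
WHAT THIS IS NOT: a statement about one linear 1-D operator; nothing here proves or refutes
`stub_scalarLiouville`, `PoloidalLiouville` or Navier–Stokes regularity.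
-/

noncomputable section

open Set Function Filter Topology MeasureTheory
open scoped Topology

namespace Literature.Analysis.FluidPDE

namespace HalfLineOU

/-! ### §2 The barrier with cubic growth -/

/-- **Cubic-growth barrier for `𝒜_C = ∂² + (C − ρ/2)∂`.**  For `C ≥ 0` there are `K ∈ C²`, `λ > 0`,
`ε > 0`, `k_M ≥ 0` with `K″ + (C − ρ/2)K′ + λK ≤ 0` on `(0,∞)`, `1 ≤ K`, `ερ³ ≤ K ≤ k_M + ερ³` on `[0,∞)`:
`K(ρ) = 1 + β∫₀^ρ e^{σ²/4−βσ}χ(σ)dσ + ερ³`, `β = 2C+2`, `χ(σ) = smoothTransition((4β−σ)/(2β))`,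
`e^{σ²/4−βσ}χ` harmonic-scale (`(e^{E}χ)′ + (C − ρ/2)e^{E}χ = −(C+2)e^{E}χ + e^{E}χ′ ≤ −(C+2)e^{E}χ`).
[cite: Lieberman1996, Ch. II Lemma 2.3 (comparison functions for the weak maximum principle)] -/
theorem exists_cubic_barrier {C : ℝ} (hC : 0 ≤ C) :
    ∃ (K K' K'' : ℝ → ℝ) (lam ε kM : ℝ), 0 < lam ∧ 0 < ε ∧ 0 ≤ kM ∧
      (∀ r, HasDerivAt K (K' r) r) ∧ (∀ r, HasDerivAt K' (K'' r) r) ∧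
      (∀ r, 0 < r → K'' r + (C - r / 2) * K' r + lam * K r ≤ 0) ∧
      (∀ r, 0 ≤ r → 1 ≤ K r) ∧ (∀ r, 0 ≤ r → ε * r ^ 3 ≤ K r) ∧
      (∀ r, 0 ≤ r → K r ≤ kM + ε * r ^ 3) := by
  set β : ℝ := 2 * C + 2 with hβ
  set δ : ℝ := C + 2 with hδ
  have hβ0 : 0 < β := by rw [hβ]; linarith
  have hβ2 : 2 ≤ β := by rw [hβ]; linarith
  have hδ0 : 0 < δ := by rw [hδ]; linarith
  have hβδ : β = C + δ := by rw [hβ, hδ]; ring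
  -- the cut-off
  set χ : ℝ → ℝ := fun σ => Real.smoothTransition ((4 * β - σ) / (2 * β)) with hχ
  have hχc : Continuous χ := by
    rw [hχ]; exact Real.smoothTransition.continuous.comp (by fun_prop)
  have hχdiff : Differentiable ℝ χ := by
    rw [hχ]
    show Differentiable ℝ (Real.smoothTransition ∘ fun σ => (4 * β - σ) / (2 * β))
    exact ((Real.smoothTransition.contDiff (n := 1)).differentiable (by simp)).comp (by fun_prop)
  have hχanti : Antitone χ := by
    rw [hχ]
    show Antitone (Real.smoothTransition ∘ fun σ => (4 * β - σ) / (2 * β))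
    refine Real.smoothTransition.monotone.comp_antitone ?_
    intro a b hab
    exact div_le_div_of_nonneg_right (by linarith) (by linarith)
  have hχ' : ∀ σ, deriv χ σ ≤ 0 := fun σ => hχanti.deriv_nonpos
  have hχd : ∀ σ, HasDerivAt χ (deriv χ σ) σ := fun σ => (hχdiff σ).hasDerivAt
  have hχ01 : ∀ σ, 0 ≤ χ σ ∧ χ σ ≤ 1 := fun σ =>
    ⟨Real.smoothTransition.nonneg _, Real.smoothTransition.le_one _⟩
  have hχone : ∀ σ, σ ≤ 2 * β → χ σ = 1 := by
    intro σ hσ; rw [hχ]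
    apply Real.smoothTransition.one_of_one_le
    rw [le_div_iff₀ (by linarith)]; linarith
  have hχzero : ∀ σ, 4 * β ≤ σ → χ σ = 0 := by
    intro σ hσ; rw [hχ]
    apply Real.smoothTransition.zero_of_nonpos
    exact div_nonpos_of_nonpos_of_nonneg (by linarith) (by linarith)
  -- the exponent and the integrand
  set ex : ℝ → ℝ := fun σ => Real.exp (σ ^ 2 / 4 - β * σ) with hex
  have hexc : Continuous ex := by rw [hex]; fun_prop
  have hex0 : ∀ σ, 0 < ex σ := fun σ => Real.exp_pos _
  have hE : ∀ r, HasDerivAt (fun σ => σ ^ 2 / 4 - β * σ) (r / 2 - β) r := by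
    intro r
    have h1 : HasDerivAt (fun σ => σ * σ / 4 - β * σ) ((1 * r + r * 1) / 4 - β * 1) r :=
      (((hasDerivAt_id' r).mul (hasDerivAt_id' r)).div_const 4).sub ((hasDerivAt_id' r).const_mul β)
    have h2 : (fun σ : ℝ => σ ^ 2 / 4 - β * σ) = fun σ => σ * σ / 4 - β * σ := by
      funext σ; ring
    rw [h2]
    exact h1.congr_deriv (by ring)
  have hexd : ∀ r, HasDerivAt ex (ex r * (r / 2 - β)) r := fun r => by
    rw [hex]; exact (hE r).exp
  set f : ℝ → ℝ := fun σ => ex σ * χ σ with hf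
  have hfc : Continuous f := by rw [hf]; exact hexc.mul hχc
  have hf0 : ∀ σ, 0 ≤ f σ := fun σ => mul_nonneg (hex0 σ).le (hχ01 σ).1
  have hfi : ∀ a c : ℝ, IntervalIntegrable f volume a c := fun a c => hfc.intervalIntegrable a c
  have hfd : ∀ r, HasDerivAt f (ex r * (r / 2 - β) * χ r + ex r * deriv χ r) r := fun r => by
    rw [hf]; exact (hexd r).mul (hχd r)
  -- the primitive
  set h : ℝ → ℝ := fun ρ => ∫ σ in (0 : ℝ)..ρ, f σ with hh
  have hhd : ∀ ρ, HasDerivAt h (f ρ) ρ := fun ρ =>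
    intervalIntegral.integral_hasDerivAt_right (hfi 0 ρ) (hfc.stronglyMeasurableAtFilter _ _)
      hfc.continuousAt
  have hh0 : h 0 = 0 := by rw [hh]; exact intervalIntegral.integral_same
  have hhpos : ∀ ρ, 0 ≤ ρ → 0 ≤ h ρ := fun ρ hρ => by
    rw [hh]; exact intervalIntegral.integral_nonneg hρ fun σ _ => hf0 σ
  -- pointwise bounds on the integrand
  have hexmin : ∀ r, Real.exp (-β ^ 2) ≤ ex r := by
    intro r; rw [hex]; apply Real.exp_le_exp.2
    nlinarith [sq_nonneg (r / 2 - β)]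
  have hfle1 : ∀ σ, 0 ≤ σ → σ ≤ 4 * β → f σ ≤ 1 := by
    intro σ h0 h4
    have h1 : ex σ ≤ 1 := by
      rw [hex, ← Real.exp_zero]; apply Real.exp_le_exp.2; nlinarith
    calc f σ = ex σ * χ σ := rfl
      _ ≤ 1 * 1 := mul_le_mul h1 (hχ01 σ).2 (hχ01 σ).1 zero_le_one
      _ = 1 := by ring
  have hfzero : ∀ σ, 4 * β ≤ σ → f σ = 0 := by
    intro σ hσ; show ex σ * χ σ = 0; rw [hχzero σ hσ, mul_zero]
  -- (H1) `h ρ ≤ 2/β` on `[0, 2β]`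
  have hH1 : ∀ ρ, 0 ≤ ρ → ρ ≤ 2 * β → h ρ ≤ 2 / β := by
    intro ρ hρ0 hρ2
    let g : ℝ → ℝ := fun σ => Real.exp (-(β / 2) * σ)
    let G : ℝ → ℝ := fun σ => -(2 / β) * Real.exp (-(β / 2) * σ)
    have hgc : Continuous g := by fun_prop
    have hGd : ∀ σ, HasDerivAt G (g σ) σ := by
      intro σ
      have h1 : HasDerivAt (fun σ => -(β / 2) * σ) (-(β / 2) * 1) σ :=
        (hasDerivAt_id' σ).const_mul (-(β / 2))
      refine ((h1.exp).const_mul (-(2 / β))).congr_deriv ?_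
      show -(2 / β) * (Real.exp (-(β / 2) * σ) * (-(β / 2) * 1)) = Real.exp (-(β / 2) * σ)
      field_simp
    have hmono : h ρ ≤ ∫ σ in (0 : ℝ)..ρ, g σ := by
      rw [hh]
      apply intervalIntegral.integral_mono_on hρ0 (hfi 0 ρ) (hgc.intervalIntegrable 0 ρ)
      intro σ hσ
      have h1 : ex σ ≤ g σ := by
        show Real.exp (σ ^ 2 / 4 - β * σ) ≤ Real.exp (-(β / 2) * σ)
        apply Real.exp_le_exp.2; nlinarith [hσ.1, hσ.2, hβ0]
      calc f σ = ex σ * χ σ := rfl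
        _ ≤ g σ * 1 := mul_le_mul h1 (hχ01 σ).2 (hχ01 σ).1 (Real.exp_pos _).le
        _ = g σ := mul_one _
    have hval : ∫ σ in (0 : ℝ)..ρ, g σ = G ρ - G 0 :=
      intervalIntegral.integral_eq_sub_of_hasDerivAt (fun σ _ => hGd σ) (hgc.intervalIntegrable 0 ρ)
    have hG0 : G 0 = -(2 / β) := by
      show -(2 / β) * Real.exp (-(β / 2) * 0) = -(2 / β); simp
    have hGρ : G ρ ≤ 0 := by
      show -(2 / β) * Real.exp (-(β / 2) * ρ) ≤ 0
      have : 0 < Real.exp (-(β / 2) * ρ) := Real.exp_pos _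
      have : 0 < 2 / β := by positivity
      nlinarith
    linarith
  -- (H2) `h ρ ≤ 2/β + 2β` for all `ρ ≥ 0`
  have hH2 : ∀ ρ, 0 ≤ ρ → h ρ ≤ 2 / β + 2 * β := by
    intro ρ hρ0
    rcases le_or_gt ρ (2 * β) with h2 | h2
    · have := hH1 ρ hρ0 h2; nlinarith
    have hsplit : h ρ = (∫ σ in (0 : ℝ)..(2 * β), f σ) + ∫ σ in (2 * β)..ρ, f σ := by
      rw [hh]; exact (intervalIntegral.integral_add_adjacent_intervals (hfi _ _) (hfi _ _)).symm
    have hA : (∫ σ in (0 : ℝ)..(2 * β), f σ) ≤ 2 / β := hH1 (2 * β) (by positivity) le_rfl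
    -- the tail `∫_{2β}^ρ f ≤ 2β`
    have htail : ∀ r, 2 * β ≤ r → r ≤ 4 * β → (∫ σ in (2 * β)..r, f σ) ≤ 2 * β := by
      intro r hr2 hr4
      have h1 : (∫ σ in (2 * β)..r, f σ) ≤ ∫ _ in (2 * β)..r, (1 : ℝ) := by
        apply intervalIntegral.integral_mono_on hr2 (hfi _ _) (continuous_const.intervalIntegrable _ _)
        intro σ hσ
        exact hfle1 σ (by linarith [hσ.1]) (by linarith [hσ.2])
      rw [intervalIntegral.integral_const, smul_eq_mul, mul_one] at h1
      linarith
    have hB : (∫ σ in (2 * β)..ρ, f σ) ≤ 2 * β := by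
      rcases le_or_gt ρ (4 * β) with h4 | h4
      · exact htail ρ h2.le h4
      have hsplit2 : (∫ σ in (2 * β)..ρ, f σ) =
          (∫ σ in (2 * β)..(4 * β), f σ) + ∫ σ in (4 * β)..ρ, f σ :=
        (intervalIntegral.integral_add_adjacent_intervals (hfi _ _) (hfi _ _)).symm
      have hz : (∫ σ in (4 * β)..ρ, f σ) = 0 := by
        have : (∫ σ in (4 * β)..ρ, f σ) = ∫ _ in (4 * β)..ρ, (0 : ℝ) := by
          apply intervalIntegral.integral_congr
          intro σ hσ
          rw [uIcc_of_le h4.le] at hσ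
          exact hfzero σ hσ.1
        rw [this, intervalIntegral.integral_zero]
      rw [hsplit2, hz, add_zero]
      exact htail (4 * β) (by linarith) le_rfl
    rw [hsplit]; linarith
  -- constants
  set e0 : ℝ := Real.exp (-β ^ 2) with he0
  have he00 : 0 < e0 := Real.exp_pos _
  set D : ℝ := 3 + 12 * β + 12 * C * β ^ 2 with hD
  have hD0 : 0 < D := by rw [hD]; positivity
  set ε : ℝ := δ * β * e0 / D with hε
  have hε0 : 0 < ε := by rw [hε]; positivity
  have hεD : ε * D = δ * β * e0 := by rw [hε]; field_simp
  have hεD' : ε * (12 * β + 12 * C * β ^ 2) + 3 * ε = δ * β * e0 := by rw [← hεD, hD]; ring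
  set kM : ℝ := 3 + 2 * β ^ 2 with hkM
  have hkM0 : 0 < kM := by rw [hkM]; positivity
  have hkM4 : kM ≤ 4 * β ^ 3 := by
    rw [hkM]; nlinarith [mul_nonneg (by linarith : (0:ℝ) ≤ β - 2) (sq_nonneg β)]
  -- `ε ≤ 1/4`
  have hε14 : ε ≤ 1 / 4 := by
    have h1 : δ * e0 ≤ 1 := by
      have hexp : β ^ 2 + 1 ≤ Real.exp (β ^ 2) := Real.add_one_le_exp _
      have hδβ : δ ≤ β ^ 2 := by rw [hβ, hδ]; nlinarith
      have h3 : e0 * Real.exp (β ^ 2) = 1 := by rw [he0, ← Real.exp_add]; simp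
      calc δ * e0 ≤ Real.exp (β ^ 2) * e0 := mul_le_mul_of_nonneg_right (by linarith) he00.le
        _ = 1 := by rw [mul_comm]; exact h3
    have h2 : ε ≤ δ * e0 / 12 := by
      rw [hε, div_le_div_iff₀ hD0 (by norm_num : (0:ℝ) < 12)]
      have hDβ : 0 ≤ D - 12 * β := by rw [hD]; nlinarith [sq_nonneg β]
      have := mul_nonneg (mul_nonneg hδ0.le he00.le) hDβ
      nlinarith
    linarith
  ---------------------------------------------------------------- the witnesses
  refine ⟨fun r => 1 + β * h r + ε * r ^ 3, fun r => β * f r + ε * (3 * r ^ 2),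
    fun r => β * (ex r * (r / 2 - β) * χ r + ex r * deriv χ r) + ε * (6 * r),
    ε, ε, kM, hε0, hε0, hkM0.le, ?_, ?_, ?_, ?_, ?_, ?_⟩
  · -- `K′`
    intro r
    have h1 : HasDerivAt (fun r => ε * r ^ 3) (ε * (3 * r ^ 2)) r := by
      have h0 : HasDerivAt (fun r : ℝ => r ^ 3) (3 * r ^ 2) r := by simpa using hasDerivAt_pow 3 r
      exact h0.const_mul ε
    have h2 := ((hhd r).const_mul β).const_add 1
    exact h2.add h1
  · -- `K″`
    intro r
    have h1 : HasDerivAt (fun r => ε * (3 * r ^ 2)) (ε * (6 * r)) r := by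
      have h0 : HasDerivAt (fun r : ℝ => r ^ 2) (2 * r) r := by simpa using hasDerivAt_pow 2 r
      exact ((h0.const_mul 3).const_mul ε).congr_deriv (by ring)
    exact ((hfd r).const_mul β).add h1
  · -- the differential inequality on `(0, ∞)`
    intro r hr
    beta_reduce
    have hfr : f r = ex r * χ r := rfl
    rw [hfr]
    generalize hH : h r = Hr at *
    have hHnn : 0 ≤ Hr := by rw [← hH]; exact hhpos r hr.le
    have hHle : Hr ≤ 2 / β + 2 * β := by rw [← hH]; exact hH2 r hr.le
    have hexr := hex0 r
    have hχr := hχ01 r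
    have hexχ : 0 ≤ ex r * χ r := mul_nonneg hexr.le hχr.1
    -- the harmonic-scale identity and the cut-off sign
    have hid : β * (ex r * (r / 2 - β) * χ r) + (C - r / 2) * (β * (ex r * χ r))
        = -(δ * β * (ex r * χ r)) := by rw [hβδ]; ring
    have hneg : β * (ex r * deriv χ r) ≤ 0 := by
      have : ex r * deriv χ r ≤ 0 := mul_nonpos_of_nonneg_of_nonpos hexr.le (hχ' r)
      nlinarith
    have hS2 : ε * (6 * r) + (C - r / 2) * (ε * (3 * r ^ 2))
        = ε * (6 * r + 3 * C * r ^ 2) - 3 / 2 * (ε * r ^ 3) := by ring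
    have hεr3 : 0 ≤ ε * r ^ 3 := by positivity
    have ht1 : ε * (ε * r ^ 3) ≤ 1 / 4 * (ε * r ^ 3) := mul_le_mul_of_nonneg_right hε14 hεr3
    have hβK : β * Hr ≤ 2 + 2 * β ^ 2 := by
      have : β * Hr ≤ β * (2 / β + 2 * β) := mul_le_mul_of_nonneg_left hHle hβ0.le
      have h2 : β * (2 / β + 2 * β) = 2 + 2 * β ^ 2 := by field_simp
      linarith
    rcases le_or_gt r (2 * β) with h2 | h2
    · -- Region A: `χ = 1`, `e^{E} ≥ e0`, `βh ≤ 2`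
      have hχ1 : χ r = 1 := hχone r h2
      have hβh : β * Hr ≤ 2 := by
        have hh1 : Hr ≤ 2 / β := by rw [← hH]; exact hH1 r hr.le h2
        calc β * Hr ≤ β * (2 / β) := mul_le_mul_of_nonneg_left hh1 hβ0.le
          _ = 2 := by field_simp
      have hsrc : δ * β * e0 ≤ δ * β * (ex r * χ r) := by
        rw [hχ1, mul_one]
        exact mul_le_mul_of_nonneg_left (hexmin r) (by positivity)
      have hr2 : r ^ 2 ≤ 4 * β ^ 2 := by
        have := mul_le_mul h2 h2 hr.le (by positivity)
        nlinarith only [this]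
      have hpoly0 : 6 * r + 3 * C * r ^ 2 ≤ 12 * β + 12 * C * β ^ 2 := by
        have := mul_le_mul_of_nonneg_left hr2 hC
        linarith only [h2, this]
      have hpoly : ε * (6 * r + 3 * C * r ^ 2) ≤ ε * (12 * β + 12 * C * β ^ 2) :=
        mul_le_mul_of_nonneg_left hpoly0 hε0.le
      have hεβh : ε * (β * Hr) ≤ ε * 2 := mul_le_mul_of_nonneg_left hβh hε0.le
      linarith only [hid, hneg, hS2, ht1, hsrc, hpoly, hεβh, hεD', hεr3]
    · -- Region B: `r ≥ 2β`: the cubic term dominates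
      have hsrc : -(δ * β * (ex r * χ r)) ≤ 0 := by
        have : 0 ≤ δ * β * (ex r * χ r) := by positivity
        linarith
      have h2' : 4 * C + 4 ≤ r := by rw [hβ] at h2; linarith
      have hq : 2 * β ^ 2 ≤ 5 / 4 * r ^ 2 - 3 * C * r - 6 := by
        have hA : 0 ≤ (r - (4 * C + 4)) * (5 / 4 * (r + (4 * C + 4)) - 3 * C) :=
          mul_nonneg (by linarith) (by linarith)
        rw [hβ]; linarith only [hA, hC]
      have ht2 : ε * r * (2 * β ^ 2) ≤ ε * r * (5 / 4 * r ^ 2 - 3 * C * r - 6) :=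
        mul_le_mul_of_nonneg_left hq (by positivity)
      have ht3 : ε * (2 * β) * (2 * β ^ 2) ≤ ε * r * (2 * β ^ 2) :=
        mul_le_mul_of_nonneg_right (mul_le_mul_of_nonneg_left h2.le hε0.le) (by positivity)
      have ht4 : ε * (β * Hr) ≤ ε * (2 + 2 * β ^ 2) := mul_le_mul_of_nonneg_left hβK hε0.le
      have ht5 : ε * kM ≤ ε * (4 * β ^ 3) := mul_le_mul_of_nonneg_left hkM4 hε0.le
      have hkMdef : kM = 3 + 2 * β ^ 2 := hkM
      linarith only [hid, hneg, hS2, ht1, hsrc, ht2, ht3, ht4, ht5, hkMdef, hεr3]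
  · -- `1 ≤ K`
    intro r hr
    beta_reduce
    have := hhpos r hr
    have : 0 ≤ ε * r ^ 3 := by positivity
    nlinarith
  · -- `ε r³ ≤ K`
    intro r hr
    beta_reduce
    have := hhpos r hr
    nlinarith
  · -- `K ≤ k_M + ε r³`
    intro r hr
    beta_reduce
    have h1 : β * h r ≤ β * (2 / β + 2 * β) := mul_le_mul_of_nonneg_left (hH2 r hr) hβ0.le
    have h2 : β * (2 / β + 2 * β) = 2 + 2 * β ^ 2 := by field_simp
    rw [hkM]; linarith

end HalfLineOU

end Literature.Analysis.FluidPDE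

end
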